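import Summits.AtomisticToContinuum.HydrodynamicLimit.Theorems.JParityClosureParityBandClosureWindowCovarianceIsotropyA
import Summits.AtomisticToContinuum.HydrodynamicLimit.Theorems.JParityClosureParityRigidityMollify
import Mathlib.Topology.TietzeExtension
import HarnessLib

/-!
# Window covariance isotropy (crux `JParityClosure.ParityBandClosure`, stmt-AtomisticToContinuum-17608, line
# `transfer-weighted-parity-chain`, stub `stub_windowCovarianceIsotropy`) — helper B: the dictionary identities

WHAT.  For one hard-sphere path and one window `(t₀, x₀)` (helper A: window law `λ_w = wlaw`, window record
`κ_w = wrec`), the EXACT identities between the window functionals of the pointwise kinetic inputs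
(`OddContactSymmetryPW`, `RateFloorPW`, in their `collisionPairSum` form) and the test functionals of `ParityStability`
applied to the normalised window law `ν_w = ρ_w⁻¹ λ_w` and to `κ_w`:

* §1 test extensions (Tietze): a bounded continuous test on `Q = (ℝ³×ℝ³)×S²` extends to a bounded continuous
  function of `(n, v, w) ∈ ℝ³×ℝ³×ℝ³` (direction slot first) agreeing with it on unit `n`; `J`-oddness on `Q`
  becomes the reflection-oddness of `OddContactSymmetryPW` on `‖n‖ = 1` (`reflectVel_eq_collide`); nonnegativity
  is kept;
* §2 the normalised window law is a probability measure and `hw = ρ_w · h^{ν_w}` (the Gaussian KDE of the window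
  is `ρ_w` times that of `ν_w`), so the surprisal jump of `OddContactSymmetryPW` IS `F^{ν_w}` (the four `log ρ_w`
  cancel) and the Metropolis-odd window functional IS `∫ Ψ min(1, e^{−F^{ν_w}}) dκ_w` (`oddFunctional_eq`);
* §3 a marked window functional IS `∫ Ξ dκ_w` (`markFunctional_eq`); the two-time reference functional of
  `RateFloorPW` is treated in helper C.

REFERENCES.  C. Cercignani, R. Illner, M. Pulvirenti, *The Mathematical Theory of Dilute Gases* (1994) §3.1
(collision map, its involutivity); P. Urysohn / H. Tietze extension (Mathlib `TietzeExtension`).  No named fact.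
-/

noncomputable section

namespace Summit.AtomisticToContinuum.HydrodynamicLimit.Theorems.ParityBandClosureWindowCovariance

open scoped BigOperators Topology Classical MeasureTheory ENNReal InnerProductSpace
open Filter Set MeasureTheory Function Topology
open Literature.MathematicalPhysics.KineticTheory
open Literature.Analysis.FluidPDE
open Summit.AtomisticToContinuum.HydrodynamicLimit.Theorems.LocalSecondLawNegative (cone cone_nonneg cone_le
  continuous_cone integral_cone_le)

variable {N : ℕ}

/-! ## §1 Test extensions -/

/-- The closed embedding `((v, w), ω) ↦ (ω, v, w)` of `Q = (ℝ³×ℝ³)×S²` into `ℝ³×ℝ³×ℝ³`. [folklore] -/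
theorem isClosedEmbedding_dirFirst :
    IsClosedEmbedding fun q : (V3 × V3) × Metric.sphere (0 : V3) 1 => ((q.2 : V3), q.1) := by
  have h1 : IsClosedEmbedding (Prod.map (Subtype.val : Metric.sphere (0 : V3) 1 → V3) (id : V3 × V3 → V3 × V3)) :=
    Metric.isClosed_sphere.isClosedEmbedding_subtypeVal.prodMap IsClosedEmbedding.id
  have h2 : IsClosedEmbedding (Homeomorph.prodComm (V3 × V3) (Metric.sphere (0 : V3) 1)) :=
    Homeomorph.isClosedEmbedding _
  exact h1.comp h2

/-- **Tietze for tests on `Q`.** A continuous test on `Q` with values in a nonempty interval `t` extends to a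
continuous function of `(n, v, w) ∈ ℝ³×ℝ³×ℝ³` with values in `t`, agreeing with the test on unit directions.
[folklore] -/
theorem exists_extension_test {Ψ : (V3 × V3) × Metric.sphere (0 : V3) 1 → ℝ} (hc : Continuous Ψ) {t : Set ℝ}
    [OrdConnected t] (ht : ∀ q, Ψ q ∈ t) (hne : t.Nonempty) :
    ∃ Ψt : V3 × V3 × V3 → ℝ, Continuous Ψt ∧ (∀ p, Ψt p ∈ t) ∧
      ∀ (n v w : V3) (hn : ‖n‖ = 1), Ψt (n, v, w) = Ψ ((v, w), ⟨n, mem_sphere_zero_iff_norm.2 hn⟩) := by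
  obtain ⟨g, hg, hge⟩ := (ContinuousMap.mk Ψ hc).exists_extension_forall_mem_of_isClosedEmbedding ht hne
    isClosedEmbedding_dirFirst
  refine ⟨g, g.continuous, hg, fun n v w hn => ?_⟩
  have h := congrFun hge ((v, w), ⟨n, mem_sphere_zero_iff_norm.2 hn⟩)
  simpa using h

/-- **Odd tests.** A bounded continuous `J`-odd test on `Q` (`J(p, ω) = (collide ω p, −ω)`) extends to a bounded
continuous function of `(n, v, w)` which on unit `n` agrees with the test and is odd under
`(n, v, w) ↦ (−n, reflectVel n (v, w))` — the format of `OddContactSymmetryPW`. [folklore] -/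
theorem exists_extension_odd {Ψ : (V3 × V3) × Metric.sphere (0 : V3) 1 → ℝ} (hc : Continuous Ψ) {C : ℝ}
    (hC : ∀ q, |Ψ q| ≤ C) (hodd : ∀ q, Ψ (collide q.2 q.1, -q.2) = -Ψ q) :
    ∃ Ψt : V3 × V3 × V3 → ℝ, Continuous Ψt ∧ (∃ C' : ℝ, ∀ p, |Ψt p| ≤ C') ∧
      (∀ (n v w : V3) (hn : ‖n‖ = 1), Ψt (n, v, w) = Ψ ((v, w), ⟨n, mem_sphere_zero_iff_norm.2 hn⟩)) ∧
      ∀ n v w : V3, ‖n‖ = 1 → Ψt (-n, (reflectVel n (v, w)).1, (reflectVel n (v, w)).2) = -Ψt (n, v, w) := by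
  have hC0 : 0 ≤ C := (abs_nonneg _).trans (hC ((0, 0), toSph 0))
  obtain ⟨Ψt, hct, hmem, heq⟩ := exists_extension_test hc (t := Set.Icc (-C) C)
    (fun q => abs_le.1 (hC q)) ⟨0, by simp [hC0]⟩
  refine ⟨Ψt, hct, ⟨C, fun p => abs_le.2 (hmem p)⟩, heq, fun n v w hn => ?_⟩
  have hn' : ‖-n‖ = 1 := by rw [norm_neg, hn]
  set ω : Metric.sphere (0 : V3) 1 := ⟨n, mem_sphere_zero_iff_norm.2 hn⟩ with hω
  have hrefl : reflectVel n (v, w) = collide ω (v, w) := reflectVel_eq_collide ω (v, w)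
  have hnegω : (⟨-n, mem_sphere_zero_iff_norm.2 hn'⟩ : Metric.sphere (0 : V3) 1) = -ω :=
    Subtype.ext (by rw [coe_neg_sphere])
  rw [heq (-n) _ _ hn', heq n v w hn, hnegω, hrefl]
  exact hodd ((v, w), ω)

/-- **Nonnegative tests.** A nonnegative bounded continuous test on `Q` extends to a nonnegative bounded continuous
function of `(n, v, w)` agreeing with it on unit `n` — the format of `RateFloorPW`. [folklore] -/
theorem exists_extension_nonneg {Ξ : (V3 × V3) × Metric.sphere (0 : V3) 1 → ℝ} (hc : Continuous Ξ)
    (h0 : ∀ q, 0 ≤ Ξ q) {C : ℝ} (hC : ∀ q, Ξ q ≤ C) :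
    ∃ Ξt : V3 × V3 × V3 → ℝ, Continuous Ξt ∧ (∀ p, 0 ≤ Ξt p) ∧ (∃ C' : ℝ, ∀ p, Ξt p ≤ C') ∧
      ∀ (n v w : V3) (hn : ‖n‖ = 1), Ξt (n, v, w) = Ξ ((v, w), ⟨n, mem_sphere_zero_iff_norm.2 hn⟩) := by
  have hC0 : 0 ≤ C := (h0 _).trans (hC ((0, 0), toSph 0))
  obtain ⟨Ξt, hct, hmem, heq⟩ := exists_extension_test hc (t := Set.Icc 0 C) (fun q => ⟨h0 q, hC q⟩)
    ⟨0, by simp [hC0]⟩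
  exact ⟨Ξt, hct, fun p => (hmem p).1, ⟨C, fun p => (hmem p).2⟩, heq⟩

/-! ## §2 The normalised window law and the Metropolis-odd window functional -/

/-- Congruence of collision pair sums on the contact triples. [folklore] -/
theorem collisionPairSum_congr {d : Type*} [Fintype d] {X : Type*} {n : ℕ} {M : Type*} [AddCommMonoid M]
    {G : Geometry d X} {ε : ℝ} {γ : ℝ → Config n d X} {S : Set ℝ} {g g' : ℝ → Fin n → Fin n → M}
    (h : ∀ t ∈ collisionTimes G ε γ ∩ S, ∀ p ∈ contactPairs G ε (γ t), g t p.1 p.2 = g' t p.1 p.2) :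
    collisionPairSum G ε γ S g = collisionPairSum G ε γ S g' :=
  finsum_mem_congr rfl fun t ht => Finset.sum_congr rfl fun p hp => h t ht p hp

/-- The Gaussian kernel of unit mass is bounded by its peak value. [folklore] -/
theorem abs_localMaxwellian_one_le {θ : ℝ} (hθ : 0 ≤ θ) (u v : V3) :
    |localMaxwellian 1 θ u v| ≤ |(2 * Real.pi * θ) ^ (-(Module.finrank ℝ V3 : ℝ) / 2)| := by
  unfold localMaxwellian
  rw [one_mul, abs_mul, abs_of_pos (Real.exp_pos _)]
  refine mul_le_of_le_one_right (abs_nonneg _) ?_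
  rw [Real.exp_le_one_iff, neg_div]
  exact neg_nonpos.2 (div_nonneg (sq_nonneg _) (by positivity))

section Window

variable {ε r τ t₀ : ℝ} {x₀ : T3} {γ : ℝ → Config (N + 1) (Fin 3) T3}

/-- The total mass of the window law, in `ℝ≥0∞`. [folklore] -/
theorem wlaw_univ_eq (hr : 0 < r) (hγ : Measurable γ) :
    wlaw r τ t₀ x₀ γ Set.univ =
      ENNReal.ofReal (∫ s in Set.Icc 0 τ, btent r (s - t₀) * ∫ q, cone r q.1 x₀ ∂(empiricalMeasure (γ s))) := by
  haveI := isFiniteMeasure_wlaw (N := N) (τ := τ) (t₀ := t₀) (x₀ := x₀) (γ := γ) hr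
  rw [← wlaw_univ_toReal hr hγ, ENNReal.ofReal_toReal (measure_ne_top _ _)]

/-- **The normalised window law `ν_w = ρ_w⁻¹ λ_w` is a probability measure** on a window of positive mass.
[folklore] -/
theorem isProbabilityMeasure_nlaw (hr : 0 < r) (hγ : Measurable γ) {ρ : ℝ}
    (hρ : ρ = ∫ s in Set.Icc 0 τ, btent r (s - t₀) * ∫ q, cone r q.1 x₀ ∂(empiricalMeasure (γ s))) (hρ0 : 0 < ρ) :
    IsProbabilityMeasure ((ENNReal.ofReal ρ)⁻¹ • wlaw r τ t₀ x₀ γ) := by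
  refine ⟨?_⟩
  rw [Measure.smul_apply, wlaw_univ_eq hr hγ, ← hρ, smul_eq_mul,
    ENNReal.inv_mul_cancel (by rwa [Ne, ENNReal.ofReal_eq_zero, not_le]) ENNReal.ofReal_ne_top]

/-- Integration against the normalised window law. [folklore] -/
theorem integral_nlaw {ρ : ℝ} (hρ0 : 0 ≤ ρ) (f : V3 → ℝ) :
    ∫ v, f v ∂((ENNReal.ofReal ρ)⁻¹ • wlaw r τ t₀ x₀ γ) = ρ⁻¹ * ∫ v, f v ∂(wlaw r τ t₀ x₀ γ) := by
  rw [integral_smul_measure, ENNReal.toReal_inv, ENNReal.toReal_ofReal hρ0, smul_eq_mul]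

/-- **The window KDE is `ρ_w` times the KDE of the normalised window law**: `hw = ρ_w · h^{ν_w}`. [folklore] -/
theorem kde_window_eq (hr : 0 < r) (hγ : Measurable γ) {ρ : ℝ} (hρ0 : 0 < ρ) (ϑ : ℝ) (a : V3) :
    (∫ s in Set.Icc 0 τ, btent r (s - t₀) *
        ∫ q, cone r q.1 x₀ * localMaxwellian 1 (ϑ ^ 2) a q.2 ∂(empiricalMeasure (γ s))) =
      ρ * ∫ v', localMaxwellian 1 (ϑ ^ 2) a v' ∂((ENNReal.ofReal ρ)⁻¹ • wlaw r τ t₀ x₀ γ) := by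
  rw [integral_nlaw hρ0.le, ← mul_assoc, mul_inv_cancel₀ hρ0.ne', one_mul]
  exact (integral_wlaw hr hγ (continuous_localMaxwellian 1 (ϑ ^ 2) a).measurable
    (fun s k => abs_localMaxwellian_one_le (sq_nonneg ϑ) a _)).symm

/-- **The Metropolis-odd window functional of `OddContactSymmetryPW` IS the odd test functional of
`ParityStability` on `(ν_w, κ_w)`** (window of positive mass): the reflection of the outgoing pair in the unit
normal is the incoming pair and conversely (`collide` is an involution), the direction slot of the extended test is
read on the unit normal, and the four `log ρ_w` of `hw = ρ_w h^{ν_w}` cancel in the surprisal jump. [folklore] -/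
theorem oddFunctional_eq (hγ : IsHardSphereTrajectory (Torus.geometry (Fin 3)) ε (N + 1) γ) (hε : 0 < ε)
    (hr : 0 < r) {ρ : ℝ}
    (hρ : ρ = ∫ s in Set.Icc 0 τ, btent r (s - t₀) * ∫ q, cone r q.1 x₀ ∂(empiricalMeasure (γ s))) (hρ0 : 0 < ρ)
    {ϑ : ℝ} (hϑ : ϑ ≠ 0)
    {Ψ : (V3 × V3) × Metric.sphere (0 : V3) 1 → ℝ} {Ψt : V3 × V3 × V3 → ℝ}
    (hΨ : ∀ (n v w : V3) (hn : ‖n‖ = 1), Ψt (n, v, w) = Ψ ((v, w), ⟨n, mem_sphere_zero_iff_norm.2 hn⟩))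
    (hw h : V3 → ℝ)
    (hhw : ∀ a, hw a = ∫ s in Set.Icc 0 τ, btent r (s - t₀) *
      ∫ q, cone r q.1 x₀ * localMaxwellian 1 (ϑ ^ 2) a q.2 ∂(empiricalMeasure (γ s)))
    (hh : ∀ a, h a = ∫ v', localMaxwellian 1 (ϑ ^ 2) a v' ∂((ENNReal.ofReal ρ)⁻¹ • wlaw r τ t₀ x₀ γ))
    (pv : ℝ → Fin (N + 1) → Fin (N + 1) → V3 × V3)
    (hpv : ∀ s i j, pv s i j =
      reflectVel ((Torus.geometry (Fin 3)).sepVec (γ s i).1 (γ s j).1) ((γ s i).2, (γ s j).2))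
    (FO : ℝ → Fin (N + 1) → Fin (N + 1) → ℝ)
    (hFO : ∀ s i j, FO s i j = Real.log (hw (pv s i j).1) + Real.log (hw (pv s i j).2) -
      Real.log (hw (γ s i).2) - Real.log (hw (γ s j).2))
    (Fν : (V3 × V3) × Metric.sphere (0 : V3) 1 → ℝ)
    (hFν : ∀ q, Fν q = Real.log (h q.1.1) + Real.log (h q.1.2) -
      Real.log (h (collide q.2 q.1).1) - Real.log (h (collide q.2 q.1).2)) :
    ε / (N + 1 : ℝ) * collisionPairSum (Torus.geometry (Fin 3)) ε γ (Set.Icc 0 τ) (fun s i j =>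
        btent r (s - t₀) * cone r (γ s i).1 x₀ *
          (Ψt (ε⁻¹ • (Torus.geometry (Fin 3)).sepVec (γ s i).1 (γ s j).1, (pv s i j).1, (pv s i j).2) *
            min 1 (Real.exp (-(FO s i j))))) =
      ∫ q, Ψ q * min 1 (Real.exp (-(Fν q))) ∂(wrec ε r τ t₀ x₀ γ) := by
  haveI := isProbabilityMeasure_nlaw (τ := τ) (t₀ := t₀) (x₀ := x₀) hr hγ.measurable_torus hρ hρ0
  -- `hw = ρ h`, so `log hw = log ρ + log h`
  have hlog : ∀ a, Real.log (hw a) = Real.log ρ + Real.log (h a) := by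
    intro a
    have hpos : 0 < h a := by
      rw [hh]; exact ParityRigidity.integral_localMaxwellian_pos _ hϑ a
    rw [hhw, kde_window_eq hr hγ.measurable_torus hρ0 ϑ a, ← hh, Real.log_mul hρ0.ne' hpos.ne']
  rw [integral_wrec hε.le hr (finite_collisionTimes_Icc hγ τ), smul_eq_mul]
  congr 1
  refine collisionPairSum_congr fun t _ p hp => ?_
  obtain ⟨hij, hsep⟩ := (mem_contactPairs_iff_of_mem (hγ.mem t)).1 hp
  set sep := (Torus.geometry (Fin 3)).sepVec (γ t p.1).1 (γ t p.2).1 with hsepdef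
  have hsep0 : sep ≠ 0 := fun h0 => hε.ne' (by rw [← hsep, h0, norm_zero])
  have hn1 : ‖ε⁻¹ • sep‖ = 1 := by
    rw [norm_smul, norm_inv, Real.norm_eq_abs, abs_of_pos hε, hsep, inv_mul_cancel₀ hε.ne']
  have htoSph : toSph (ε⁻¹ • sep) = ⟨ε⁻¹ • sep, mem_sphere_zero_iff_norm.2 hn1⟩ := Subtype.ext (coe_toSph hn1)
  have hunit : unitDir sep hsep0 = toSph (ε⁻¹ • sep) := by
    refine Subtype.ext ?_
    rw [coe_toSph hn1]
    show ‖sep‖⁻¹ • sep = ε⁻¹ • sep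
    rw [hsep]
  -- the record point and the collision involution
  have hrec : recPt ε (γ t) p.1 p.2 = (pv t p.1 p.2, toSph (ε⁻¹ • sep)) := by rw [hpv]; rfl
  have hcoll : collide (toSph (ε⁻¹ • sep)) (pv t p.1 p.2) = ((γ t p.1).2, (γ t p.2).2) := by
    rw [hpv, ← hsepdef, reflectVel_eq_collide_unitDir sep hsep0, hunit, collide_collide]
  rw [smul_eq_mul, hrec]
  congr 2
  · rw [hΨ _ _ _ hn1, ← htoSph]
  · rw [hFν, hFO, hcoll, hlog, hlog, hlog, hlog]
    ring_nf

/-! ## §3 Marked functionals and the two-time floor functional -/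

/-- **A marked window functional IS `∫ Ξ dκ_w`** for any mark read on the unit normal. [folklore] -/
theorem markFunctional_eq (hγ : IsHardSphereTrajectory (Torus.geometry (Fin 3)) ε (N + 1) γ) (hε : 0 < ε)
    (hr : 0 < r) {Ξ : (V3 × V3) × Metric.sphere (0 : V3) 1 → ℝ} {Ξt : V3 × V3 × V3 → ℝ}
    (hΞ : ∀ (n v w : V3) (hn : ‖n‖ = 1), Ξt (n, v, w) = Ξ ((v, w), ⟨n, mem_sphere_zero_iff_norm.2 hn⟩))
    (pv : ℝ → Fin (N + 1) → Fin (N + 1) → V3 × V3)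
    (hpv : ∀ s i j, pv s i j =
      reflectVel ((Torus.geometry (Fin 3)).sepVec (γ s i).1 (γ s j).1) ((γ s i).2, (γ s j).2)) :
    ε / (N + 1 : ℝ) * collisionPairSum (Torus.geometry (Fin 3)) ε γ (Set.Icc 0 τ) (fun s i j =>
        btent r (s - t₀) * cone r (γ s i).1 x₀ *
          Ξt (ε⁻¹ • (Torus.geometry (Fin 3)).sepVec (γ s i).1 (γ s j).1, (pv s i j).1, (pv s i j).2)) =
      ∫ q, Ξ q ∂(wrec ε r τ t₀ x₀ γ) := by
  rw [integral_wrec hε.le hr (finite_collisionTimes_Icc hγ τ), smul_eq_mul]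
  congr 1
  refine collisionPairSum_congr fun t _ p hp => ?_
  obtain ⟨_, hsep⟩ := (mem_contactPairs_iff_of_mem (hγ.mem t)).1 hp
  have hn1 : ‖ε⁻¹ • (Torus.geometry (Fin 3)).sepVec (γ t p.1).1 (γ t p.2).1‖ = 1 := by
    rw [norm_smul, norm_inv, Real.norm_eq_abs, abs_of_pos hε, hsep, inv_mul_cancel₀ hε.ne']
  have hrec : recPt ε (γ t) p.1 p.2 =
      (pv t p.1 p.2, toSph (ε⁻¹ • (Torus.geometry (Fin 3)).sepVec (γ t p.1).1 (γ t p.2).1)) := by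
    rw [hpv]; rfl
  rw [smul_eq_mul, hrec, hΨ_aux hΞ hn1]
where
  /-- reading the mark on the unit normal -/
  hΨ_aux {Ξ : (V3 × V3) × Metric.sphere (0 : V3) 1 → ℝ} {Ξt : V3 × V3 × V3 → ℝ}
      (hΞ : ∀ (n v w : V3) (hn : ‖n‖ = 1), Ξt (n, v, w) = Ξ ((v, w), ⟨n, mem_sphere_zero_iff_norm.2 hn⟩))
      {n : V3} (hn1 : ‖n‖ = 1) {pq : V3 × V3} : Ξt (n, pq.1, pq.2) = Ξ (pq, toSph n) := by
    have e : (⟨n, mem_sphere_zero_iff_norm.2 hn1⟩ : Metric.sphere (0 : V3) 1) = toSph n :=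
      Subtype.ext (coe_toSph hn1).symm
    rw [hΞ _ _ _ hn1, e]

/-- **Registered sub-goal `stub_wciMaxwellianPeak` (helper B of `stub_windowCovarianceIsotropy`): the unit-mass
Gaussian kernel of the window KDE is bounded by its peak** (the bound that makes the window KDE an honest integral
against the window law). [folklore] -/
theorem stub_wciMaxwellianPeak : ∀ {θ : ℝ}, 0 ≤ θ → ∀ u v : EuclideanSpace ℝ (Fin 3), |Literature.Analysis.FluidPDE.localMaxwellian 1 θ u v| ≤ |(2 * Real.pi * θ) ^ (-(Module.finrank ℝ (EuclideanSpace ℝ (Fin 3)) : ℝ) / 2)| :=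
  fun hθ u v => abs_localMaxwellian_one_le hθ u v

end Window

end Summit.AtomisticToContinuum.HydrodynamicLimit.Theorems.ParityBandClosureWindowCovariance

end
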